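import Mathlib
import HarnessLib
import HarnessLib.Audit
import Summits.AtomisticToContinuum.Statement
import Literature.MathematicalPhysics.KineticTheory.InfiniteChainDynamics
import Literature.MathematicalPhysics.KineticTheory.InfiniteChainInvariantStates
import Summits.AtomisticToContinuum.FouriersLaw.Theorems.JunctionLocalitySuperadditiveFekete
import Summits.AtomisticToContinuum.FouriersLaw.Theorems.EmbeddedDrudeMourreNessUnique
import Summits.AtomisticToContinuum.FouriersLaw.Theorems.OddSectorIrreversibilityBoundedResponseConvergesStubPositiveConductance
import Summits.AtomisticToContinuum.FouriersLaw.Theorems.FourierGreenKuboFourierFiniteResponseOfUnique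
import Summits.AtomisticToContinuum.FouriersLaw.Theorems.ContactEchoEpochsPinnedSteadyStateExists
import HarnessLib.Audit.Status.Attr

/-!
Route: ParityLiouvilleSeed

# Route ParityLiouvilleSeed — Liouville for heat (odd-sector macro-ergodicity) supplies NOT
BALLISTIC; junction superadditivity turns it into Fourier's law

X = X_R ∧ X_U ∧ X_J ("it suffices to show"), the CONFORMING re-filing of the retired rung route
ParityLiouville (card
macro-ergodicity-parity-antiballistic; retired 2026-08-15 `not-a-thesis` because its assembly
stopped at BoundaryThermalisation) with the
transfer to the Statement now explicit and the deciding theorem PROVED. X_R (RIGIDITY HALF, this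
card's mechanism): ZeroCurrentRigidity —
every shift-invariant, time-invariant (∫𝒜f dν = 0), regular probability measure of the INFINITE
deterministic pinned chain carries zero mean
bond current (the odd sector of macro-ergodicity: Gibbs mixtures are even under p ↦ −p, j₀ is odd) —
together with the two N-uniform a-priori
inputs NessRegularity (box relative entropies of the steady states ≤ C|Λ| w.r.t. one shift-invariant
Gibbs state) and NessTightness (N- and
site-uniform moments); by the support items CesaroUpgrade (Cesàro averaging over shifts: LIOUVILLE
THEOREM FOR HEAT, no shift-invariance
assumed) and WindowLimit (bulk-window compactness + stationarity transfer) these give, inside the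
proof of `closes`, the anti-ballistic rung
J̃_N(T_L,T_R) → 0 at every FIXED pair of temperatures and for every steady-state family. X_U (THE
BRIDGE TO BLR's ORDER OF LIMITS, new crux):
UniformLinearRegime — the linear-response regime of the per-bond current has N-uniform width; with
the rung it yields NOT BALLISTIC at linear
response, liminf_N D_N/(N−1) = 0 (verbatim the crux NonBallistic, stmt-2192, of the retired route
SuperadditiveJunction). X_J (JUNCTION HALF,
imported verbatim from SuperadditiveJunction): SuperadditiveResistance (R_{N+M} ≥ R_N + R_M − C for
R_N = (N−1)/D_N) and the necessary
conditions ConductanceLowerBound, PositiveConductance; the real-analysis lemma SuperadditiveFekete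
turns "superadditive + one length with
R_{N₀} > C + Ohmic lower bound" into D_N → κ(T) ∈ (0,∞). Frame: NessUnique, PinnedSteadyStateExists,
FiniteResponseOfUnique.
Lean: `ZeroCurrentRigidity ∧ NessRegularity ∧ NessTightness ∧ UniformLinearRegime ∧
SuperadditiveResistance`

## Assembly
The deciding theorem `theorem closes (hNU : NessUnique) (hE : PinnedSteadyStateExists) (hFR :
FiniteResponseOfUnique) (hP : PositiveConductance)
(hCL : ConductanceLowerBound) (hA : SuperadditiveResistance) (hF : SuperadditiveFekete) (hZ :
ZeroCurrentRigidity) (hR : NessRegularity)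
(hT : NessTightness) (hW : WindowLimit) (hCU : CesaroUpgrade) (hU : UniformLinearRegime) :
_root_.FouriersLaw` is PROVED sorry-free in the
planner folder (Sketch.lean / glue.lean, lean check rc 0, axioms propext, Classical.choice,
Quot.sound; ~130 lines of real analysis) and every
hypothesis is USED. Proof: fix parameters > 0; clause (i) from PinnedSteadyStateExists + NessUnique.
STEP A (the rung, in-proof): for T_L,
T_R > 0 and any steady family ν, if totalCurrent(ν_N)/(N−1) ↛ 0 then Metric.tendsto_nhds gives ε > 0
with ∃ᶠ N, ε ≤ |J̃_N|; NessTightness /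
NessRegularity instantiate the two a-priori hypotheses of WindowLimit, which yields ν_∞ with ε ≤ |∫
j₀ dν_∞| while CesaroUpgrade hZ :
LiouvilleForHeat gives ∫ j₀ dν_∞ = 0 — contradiction. STEP B: canonical family μ₀ by
Classical.choose; for T > 0, FiniteResponseOfUnique gives
D (choice), PositiveConductance / ConductanceLowerBound / SuperadditiveResistance its constants; NOT
BALLISTIC for D: given ε, N₀ take δ₀ from
UniformLinearRegime at ε/4, δ = min(δ₀/2, T), apply STEP A at (T+δ/2, T−δ/2) to get N ≥ max(N₀,2)
with |J̃_N| < (ε/4)δ(N−1), whence D_N ≤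
|D_N − tc/δ| + |tc/δ| ≤ (ε/4)N + (ε/4)(N−1) ≤ ε(N−1); SuperadditiveFekete then gives κ_T > 0 with D
→ κ_T. STEP C: κ(T) := κ_T (1 for T ≤ 0);
for an arbitrary steady family uniqueness makes the difference quotients agree for |δ| < 2T
(Filter.Tendsto.congr'), so D serves it too.

Rationale: WHY THIS LINE. Nobody can prove even J̃_N → 0 for a deterministic anharmonic bulk
(BonettoLebowitzReyBellet2000 §6.3, Bernardin2014 §2); the card's observation
is that the catalogued open input of hydrodynamic limits, macro-ergodicity (Bernardin2014 Def. 1,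
FritzFunakiLebowitz1994), already PAYS at the
anti-ballistic rung through its odd sector alone and with no hydrodynamic limit, one-block estimate
or sector condition: in a time-invariant
state the mean current is bond-independent (continuity equation), so it survives Cesàro averaging
over translations, and it vanishes in
every Gibbs mixture by momentum parity — "no steady heat flux through an infinite thermalising
medium", the separatrix violated exactly by the
harmonic member (SpohnLebowitz1977 radiating states); NESS ⇒ infinite-volume stationary state ⇒
characterisation is the Eyink–Lebowitz–Spohn
architecture (EyinkLebowitzSpohn1991) transplanted to bulk windows of the deterministic chain
(infinite-volume ergodic theory / Gibbs
characterisation programme: FritzFunakiLebowitz1994, LiveraniOlla1996; weak compactness and entropy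
l.s.c.: KipnisLandim1999). What is NEW
against the retired ParityLiouville is the honest transfer to the conjunct: a fixed-bias rung cannot
see δ → 0 (proved impossible without
uniformity: pointwise limits do not differentiate), so the bridge UniformLinearRegime is filed as a
typed crux, and the complementary
quantitative half is IMPORTED, not re-invented — the three-length comparison of
SuperadditiveJunction (Hammersley1988 /
ArmstrongKuusiMourrat2019 finite-size-criterion architecture; Büttiker-probe series law
Buttiker1986), whose own open seed "not ballistic"
(their crux (B), 'soft way (b)') is precisely what this line manufactures for ALL parameters and
temperatures at once, where a certificate
gives one (T, N₀) at a time. The dichotomy proved there (two-sided junction locality ⇒ ballistic OR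
Fourier with 1/N rate) matches the two
cases of the rigidity statement (harmonic radiating states ↔ ballistic branch; ZeroCurrentRigidity ↔
Fourier branch) — that correspondence
is the thesis. Negatives index: 6 refuted statements of the summit, none in this sub (checked
19:04Z).

RANKED CRUXES. #2 ZeroCurrentRigidity (crux) — ODD-SECTOR MACRO-ERGODICITY of the infinite chain
(card M3/M4; = the consequent of CurrentTiltQuench.OddRigidityTransfer stmt-11035 and, up to the
alias→original renames, LocalOhmRigidity/ParityLiouville stmt-2739): for ω₂, lam, β > 0 every
probability measure on (ℝ×ℝ)^ℤ that is shift-invariant, time-invariant in generator form and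
regular, with j₀ integrable, has ∫ j₀ dν = 0. Implied by MacroErgodicityHypothesis through parity
(CurrentTiltQuench stmt-11034 ∘ 11035, provable-now); false at lam = β = 0. [difficulty:
open-problem] (why it might fail: Regular current-carrying invariant states may exist without
integrability: KAM/breather families (FFL1994 p.215) or a hidden quasi-local odd conserved charge
(Mazur); open for every anharmonic chain; regularity alone does not kill currents (harmonic case).)
[FritzFunakiLebowitz1994, Bernardin2014, SpohnLebowitz1977, LiveraniOlla1996, Mazur1969]
#3 NessRegularity (crux) — N-UNIFORM REGULARITY OF THE NESS (card M2; ParityLiouville stmt-5371 with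
original vocabulary names): for pinnedChain (all parameters > 0) and T_L, T_R > 0 there are T > 0, a
SHIFT-INVARIANT infinite-volume Gibbs state μ_T and C < ∞ with H(μ|_Λ ‖ μ_T|_Λ) ≤ C(n+1) for every
N, every weak steady state μ of the N-chain and every box Λ = {a,…,a+n} ⊆ {0,…,N−1}. Makes window
limits regular, i.e. inside the scope of macro-ergodicity. [difficulty: XL] (why it might fail: No
N-uniform a-priori estimate exists for a Hamiltonian-bulk NESS; the entropy bound needs bulk
Fisher-information control (quantitative hypoellipticity uniform in N, Villani2009 §9.2); a singular
exotic weak steady state would give klDiv = ∞.) [Bernardin2014, EckmannPilletReyBellet1999b,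
BernardinOlla2005, Villani2009, BeckerMenegaki2022]
#4 NessTightness (crux) — N- AND SITE-UNIFORM MOMENT BOUNDS (card M1; identical to
SingleThermostatRigidity/ParityLiouville stmt-3257): for all parameters > 0, T_L, T_R > 0 and every
m there is C with ∫(|q_i|^m + |p_i|^m) dμ ≤ C for every N, every weak steady state μ of the N-chain
and every site i. Supplies tightness and uniform integrability (cubic forces, quartic currents) for
WindowLimit. [difficulty: L] (why it might fail: No N-uniform moment bound is known for any
Hamiltonian-bulk chain (Bernardin2014 §2: 'polynomial in N'); Lyapunov constants of CEHR2018 grow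
with N; stiff pinning heats tails (Hairer2009); pinnedChain is the borderline degree 4 = 4.)
[Bernardin2014, CuneoEckmannHairerReyBellet2018, Hairer2009, HairerMattingly2009,
EckmannPilletReyBellet1999b]
#5 UniformLinearRegime (crux) — N-UNIFORM LINEAR REGIME OF THE PER-BOND CURRENT (new; the bridge
from fixed bias to BLR's δ → 0 first, stated in the weakest form `closes` needs): under weak-NESS
uniqueness, for every steady family, T > 0 and response coefficients D_N: ∀ ε > 0 ∃ δ₀ > 0 such that
for every 0 < δ < δ₀, for all sufficiently large N (threshold may depend on δ),
|totalCurrent(μ_{N,T+δ/2,T−δ/2})/δ − D_N| ≤ εN — i.e. lim_{δ↓0} limsup_N |J̃_N(δ)/δ − G_N| = 0 with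
G_N = D_N/(N−1) the conductance: the large-N nonlinear defect of the per-bond current vanishes with
the bias. Diffusive picture: the defect is O(δ²/N) (J̃_N ≈ N⁻¹∫_{T−δ/2}^{T+δ/2}κ, odd in δ);
ballistic member: exactly 0. With the rung it gives NonBallistic (stmt-2192) inside `closes`.
[difficulty: L] (why it might fail: Fails iff the linear regime shrinks with N (conductance a
function of Nδ: a bias-generated mean free path ~1/δ, as at T→0); nonlinear response does scale with
N at large bias (He–Ai–Chan–Hu 2010, NDTR); no N-uniform bound on any NESS response exists.)
[doi:10.1103/physreve.81.041131, KunduDharNarayan2009, BonettoLebowitzReyBellet2000,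
arXiv:2604.00777]
#6 SuperadditiveResistance (crux) — IMPORTED JUNCTION HALF (verbatim crux (A) of the retired route
SuperadditiveJunction, stmt-2191; card superadditive-junction-dichotomy /
insertion-cost-superadditive-half): under weak-NESS uniqueness, for every steady family, T > 0 and
D_N > 0 (N ≥ 2): ∃ C(T) with R_{N+M} ≥ R_N + R_M − C for all N, M ≥ 2, R_N := (N−1)/D_N — cutting
the chain and re-thermalising the cut raises the resistance by at most a contact constant. Carries
1/N-rate content (not implied by the conjunct): the imported bet; its own line re-files it in
parallel (shared decl by signature). [difficulty: XL] (why it might fail: Junction-repair cost may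
grow with N, M if optimal response fields carry junction-crossing coherent structure at all scales
(long mean free path; C(T)↑∞ as T→0 must be allowed); no sign principle is known; fails exactly for
superdiffusive transport.) [GaudilliereLandim2013, LandimMarianiSeo2018, arXiv:1105.0493,
ReyBellet2003, Buttiker1986, Hammersley1988]
#9 NessUnique (support) — UNIQUENESS OF THE WEAK STEADY STATE (shared frame item stmt-0741,
verbatim): for pinnedChain (all > 0), every N and T_L, T_R > 0, any two measures in the class
IsSteadyState coincide (CEHR2018 Thm 2.13(1) + identification of weak Fokker–Planck solutions with
the invariant measure). [difficulty: M] [CuneoEckmannHairerReyBellet2018, Carmona2007]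
#9 PinnedSteadyStateExists (support) — EXISTENCE OF A WEAK STEADY STATE for every N, T_L, T_R > 0
(shared item stmt-9900 of PorousMediumCorner, verbatim; PROVED in tree as
pinnedChain_exists_isSteadyState in LangevinChainNESSHolds — an item so that the Theses file keeps
the Langevin-SDE cone out of its imports; a one-line Theorems file closes it). [difficulty:
provable-now] [CuneoEckmannHairerReyBellet2018]
#9 FiniteResponseOfUnique (support) — FINITE-N LINEAR RESPONSE EXISTS under uniqueness (shared frame
item stmt-0717, verbatim): D_N(T) = lim_{δ→0,δ≠0} totalCurrent(μ_{N,T+δ/2,T−δ/2})/δ exists for every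
T > 0 and N (fixed-N hypoelliptic regularity / finite-volume Green–Kubo). [difficulty: M]
[ReyBellet2003, HairerMajda2009, CuneoEckmannHairerReyBellet2018]
#9 PositiveConductance (support) — POSITIVE CONDUCTANCE AT EVERY FINITE LENGTH N ≥ 2 (shared item
stmt-2188, verbatim): the finite-volume Kubo variance is non-degenerate, so D_N > 0; needed to form
R_N = (N−1)/D_N. [difficulty: M] [ReyBellet2003, KunduDharNarayan2009, EckmannPilletReyBellet1999b]
#9 ConductanceLowerBound (support) — NOT INSULATING (shared item stmt-2193 of SuperadditiveJunction,
verbatim; a NECESSARY condition of the conjunct, hence support here): liminf_N D_N > 0 — ∃ c > 0, N₁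
with D_N ≥ c for N ≥ N₁; caps the Fekete slope (κ ≥ c). Suppliers elsewhere: TUR/fluctuation bounds,
comparison with the conservative-noise chain, QuasiSubadditiveResistance + PositiveConductance.
[difficulty: XL] [DeRoeckHuveneers2015, BernardinOlla2005, BasileBernardinOlla2009,
BonettoLebowitzReyBellet2000]
#9 SuperadditiveFekete (support) — FEKETE GLUE (pure real analysis; shared item stmt-2195 of
SuperadditiveJunction, verbatim): for a real sequence D with D_N > 0 (N ≥ 2), eventually D_N ≥ c >
0, resistances R_N = (N−1)/D_N superadditive up to C on {N, M ≥ 2}, and the non-ballistic property,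
D converges to some κ > 0 (a_N := R_N − C superadditive; N = qm + r with r ∈ {2,…,m+1} gives liminf
a_N/N ≥ a_m/m; sup ∈ (0, 1/c]). [difficulty: provable-now] [Hammersley1988]
#9 LiouvilleForHeat (support) — LIOUVILLE THEOREM FOR HEAT (card M3, the stand-alone deliverable;
ParityLiouville stmt-5372 with original vocabulary names): for ω₂, lam, β > 0 every probability
measure on (ℝ×ℝ)^ℤ that is time-invariant, translation-BOUNDED (all polynomial site moments bounded
uniformly in the site) and uniformly regular (box relative entropies ≤ C(n+1) w.r.t. one
shift-invariant Gibbs state), with j₀ integrable, has ∫ j₀ dν = 0 — shift-invariance NOT assumed.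
False for the harmonic chain (SpohnLebowitz1977), printed there (§7(iii)) as an expectation for
anharmonic crystals. Closed by CesaroUpgrade + ZeroCurrentRigidity, or directly. [difficulty:
open-problem] [SpohnLebowitz1977, FritzFunakiLebowitz1994, Bernardin2014]
#9 CesaroUpgrade (support) — GLUE ZeroCurrentRigidity → LiouvilleForHeat (ParityLiouville stmt-5373;
provable, ~1–2 weeks of Lean): Cesàro-average ν over shifts (time-invariance, site-uniform moments
and — convexity of klDiv in the first argument, shift-invariant reference — the regularity constant
are preserved); tightness from moments; along a subsequence a shift-invariant, time-invariant
(uniform integrability of 𝒜f from moments of order > 3), regular (l.s.c. of klDiv box by box) limit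
ν̄ with j₀ ∈ L¹; BOND-INDEPENDENCE 𝒜e_k = j_{k−1} − j_k (cut-offs, dominated convergence) gives
ν(j_k) = ν(j₀) for all k, so ν̄(j₀) = ν(j₀), which ZeroCurrentRigidity kills. [difficulty: M]
[Bernardin2014, KipnisLandim1999, LanfordLebowitzLieb1977]
#9 WindowLimit (support) — BULK WINDOW COMPACTNESS (ParityLiouville stmt-5375 with original
vocabulary names; provable, no sign conditions): for any real parameters and any family (μ_N) of
weak steady states with site-uniform moments (NessTightness shape) and uniform regularity w.r.t. a
shift-invariant Gibbs reference (NessRegularity shape), if for some ε > 0 frequently ε ≤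
|totalCurrent(μ_N)/(N−1)|, then some probability measure ν on (ℝ×ℝ)^ℤ is time-invariant,
translation-bounded, uniformly regular w.r.t. the same reference, with j₀ integrable and ε ≤ |∫ j₀
dν| (windows centred at ⌊N/2⌋, Prokhorov, stationarity transfer — bath terms do not touch bulk
coordinates —, bond currents of a steady state all equal J̃_N, uniform integrability from moments >
4). [difficulty: M] [EyinkLebowitzSpohn1991, LanfordLebowitzLieb1977, KipnisLandim1999,
SpohnLebowitz1977]

TWO-LAYER PLAN. Foreseen glued splits (nothing filed now): NessRegularity ⇐ BathFisherBudget
(entropy production identity γΣT_α·I(μ_N|p_α ‖ Maxwellian) = σ_N ≤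
J̃_N(1/T_R − 1/T_L), N-uniform) → BulkFisherNoPileUp (site-wise relative Fisher information bounded
uniformly; with the dimension-free LSI of the
uniformly log-concave reference this is the box entropy bound) → NessRegularity (k = 2).
ZeroCurrentRigidity ⇐ NoLocalIntegrals (Levi–Yamilov
census, LocalOhmRigidity's kill test) → TiltStability → ZeroCurrentRigidity (k = 2), or the FFL
upgrade (reflection/exchange symmetry earned from
stationarity + regularity, FritzFunakiLebowitz1994 Thms 2.1–2.2 beyond bounded U″, V″).
NessTightness ⇐ end-window bounds → bulk propagation
(k = 2, shared with the single-thermostat line). UniformLinearRegime ⇐ N-uniform bound on the second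
δ-derivative of the per-bond current near
equilibrium (odd symmetry of the homogeneous chain kills the δ² term of J̃_N) → UniformLinearRegime.
The fixed-bias waypoints proved INSIDE `closes`
— AntiBallistic (third conjunct of SingleThermostatRigidity.BoundaryThermalisation, stmt-3255) and
NonBallistic (stmt-2192 / BondHeatUncertainty
stmt-9127) — can be filed as support items by the tenure planner if another line wants to consume
them; an independent proof of stmt-2192 (one
certified N₀ given an explicit C(T), or BondHeatUncertainty.TransferToNonBallistic) lets tenure
re-point `closes` past cruxes 2–5.

KILL CRITERIA. A shift-invariant, time-invariant, regular state of the infinite ANHARMONIC pinned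
chain with non-zero mean current (¬ZeroCurrentRigidity — a
hidden odd conserved charge, then Mazur makes FouriersLaw itself doubtful, or KAM/breather debris
that turns out regular) closes the route
`refuted:ZeroCurrentRigidity` (and CurrentTiltQuench's transfer with it) and is a headline result.
N-growing NESS box entropies
(¬NessRegularity) with bounded moments force a pivot to a moments-only rigidity class
(LiouvilleForHeat with 'finite entropy DENSITY' in place
of uniform regularity, if credible) or close the route; N-growing moments (¬NessTightness) kill this
line and the single-thermostat line alike.
¬UniformLinearRegime (a linear regime shrinking with N at fixed T > 0) forces a pivot of the bridge
to the linearised rigidity of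
LocalOhmRigidity/LiouvilleLadder (first-order perturbations) — this route then closes `superseded`.
¬SuperadditiveResistance (numerics showing
|D_N − κ| decaying slower than 1/N, or a theorem exhibiting superdiffusive enhancement in a pinned
chain) kills the imported half: pivot the
transfer to BondHeatUncertainty.PositiveOrInfiniteLimit-type slots is NOT possible from o(N) alone,
so the route closes `refuted:SuperadditiveResistance`
unless a two-sided junction-locality variant with C = o(N) survives. FouriersLaw proved through
FourierGreenKubo/OddSectorIrreversibility moots
the route but not LiouvilleForHeat / ZeroCurrentRigidity, which stay deliverables.

NOT DECOMPOSED YET. The parity link MacroErgodicityHypothesis ⇒ ZeroCurrentRigidity is NOT re-filed: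
it is CurrentTiltQuench's OddRigidityOfMacroErgodicity ∘
OddRigidityTransfer (stmt-11034/11035, provable-now, conjecture body written out as a hypothesis).
The card's further payoffs are deliberately
left out: P2 (partitioning protocol, Cesàro-vanishing quench current — needs infinite-volume
dynamics for non-Gibbs data) and P3 (bulk LTE up to
mixture from the FULL hypothesis); the engines E1 (FFL upgrade) / E2 (KMS-stability,
Aizenman–Goldstein–Gruber–Lebowitz–Martin) for the
hypothesis itself; E3 (measure rigidity) belongs to card macroergodicity-as-x2x3-rigidity. Also not
decomposed: the l.s.c./convexity API of klDiv
under weak limits (provers attach it with --supports WindowLimit/CesaroUpgrade), existence +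
shift-invariance of the infinite-volume Gibbs state
of pinnedChain (needed to inhabit NessRegularity's witness; DLR uniqueness in d = 1), the
contact-temperature half of the rung (ExactBalance,
stmt-3259, not needed for the conjunct), the certificate technology and the junction-repair lemma
inside the imported half (their own line), and
the T-dependence of all constants (allowed to blow up as T → 0).

CHEAPEST FALSIFIER. (1) Paper check, minutes: does 'regular' already kill currents? No —
SpohnLebowitz1977's radiating states are Gaussian with spectral densities
comparable to Gibbs, hence regular; so ZeroCurrentRigidity is genuinely anharmonic (consistent, not
a kill). (2) UniformLinearRegime by
numerics (kit MD, a day; not run here — plancard budget, hub compute-free): pinnedChain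
ω₂=lam=β=γ=1, T = 1, δ ∈ {0.4, 0.2, 0.1, 0.05},
N ∈ {16,…,256}: the defect |J̃_N(δ)/δ − J̃_N(δ/2)/(δ/2)| must be bounded uniformly in N (expected to
DEcrease like 1/N); growth with N kills
crux 5 and with it this transfer. (3) The Levi–Yamilov integrability census (NoLocalIntegrals of
LocalOhmRigidity; sympy, an afternoon):
conservation-law conditions met at some (ω₂, lam, β) > 0 produce tilted radiating states and kill
ZeroCurrentRigidity there. (4) For the
imported half: Δ_k = R_{2N} − 2R_N from nonequilibrium MD (N = 2^k ≤ 128) drifting to −∞ kills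
SuperadditiveResistance.

NUMBERS. Harmonic calibration: J̃_N → c_∞(T_L − T_R) > 0 (RiederLebowitzLieb1967;
HarmonicChainBallisticFlux_holds in tree), so the rung, ZeroCurrentRigidity
and NonBallistic all fail at lam = β = 0 while UniformLinearRegime (J̃_N exactly linear in δ) and
SuperadditiveResistance (R_N bounded,
two-sided locality) hold there — the line cannot prove too much, and every anharmonic input sits in
cruxes 2–4. Kinetic regime: κ(T) ∼ (lam T)⁻²
(AokiLukkarinenSpohn2006), so C(T), δ₀(ε, T)⁻¹ and the regularity constants may blow up as T → 0
(allowed: T fixed throughout). Diffusive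
heuristics for crux 5: J̃_N(δ)/δ − G_N ≈ κ″(T)δ²/(24N) + O(δ²/N²) (contact layers), far inside the
εN allowance. Items at open: 15 (5 cruxes,
9 support, 1 assembly); `closes` has 13 hypotheses, all used.

DEFINITION REQUESTS. None. Every constant exists: OscillatorChain.IsSteadyState / totalCurrent /
pinnedChain / PhaseSpace (Literature/MathematicalPhysics/KineticTheory/FouriersLaw.lean),
ChainConfig / OscillatorChain.bondCurrentZ / OscillatorChain.IsChainGibbsMeasure
(InfiniteChainDynamics.lean), IsShiftInvariant / IsTimeInvariant /
IsRegular / boxMarginal (InfiniteChainInvariantStates.lean), InformationTheory.klDiv, Fin.castLE /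
Fin.natAdd (Mathlib). The Barriers module
MacroErgodicityHypothesis (aliases + the @[conjecture]) and LangevinChainNESSHolds are deliberately
NOT imported (clean cone; existence is the item
PinnedSteadyStateExists). Literature wanted (cite-only, not blocking): EyinkLebowitzSpohn1991
(acq-02372), BernardinOlla2005 (acq-00023).

Novelty: Searches (2026-08-15, this planner): `lit frontier AtomisticToContinuum --since 2020` (30 rows;
relevant arXiv:2310.13338 Canestrari–Liverani–Olla
heat equation from deterministic dynamics + chaotic forcing, arXiv:2604.14056 specific heat of
driven chains, arXiv:2604.00777 negative differential
heat conductivity in a harmonic chain + particle reservoir, arXiv:2602.07988 hierarchical Lorentz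
mirror normal transport — none on infinite-volume
rigidity or N-uniform linear regimes); `lit bridges AtomisticToContinuum --cross any` (nothing on
stationary states of infinite chains or series
laws); crossref "nonlinear response heat current anharmonic chain … linear response regime validity"
(0 relevant) and "Origin of negative
differential thermal resistance …" (doi:10.1103/physrevb.80.104302, doi:10.1103/physreve.81.041131
He–Ai–Chan–Hu 2010 'Heat conduction in the
nonlinear response regime: scaling, boundary jumps, NDTR' — the nearest print on N-scaling of
nonlinear response, physics numerics); s2
"negative differential thermal resistance" (12, engineering/fluids); zbMATH "stationary states
infinite anharmonic chain energy current Gibbs" (0);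
`lit search --hybrid` local (Livi–Politi 2017 ch. on heat transport, Evans–Morriss; nothing
specific); `lit galaxy search --star all`
"translation invariant stationary states" (4 rows: ASEP shocks, Fritz elastodynamics — noise),
"linear response regime shrinks" (1, spin glass),
`--star pdf --title-contains conductivity "superadditiv"` (noise); p  [refs: 10.1103/physrevb.80.104302, 10.1103/physreve.81.041131, 10.1007/bf01199023, 10.1007/bf01614132, 10.1007/bf02099293, 10.1017/s002190020004047x, 10.1007/bf02099293:, 2310.13338, 2604.14056, 2604.00777, 2602.07988, 1407.7023, doi:10.1103/physrevb.80.104302, doi:10.1103/physreve.81.041131, doi:10.1007/bf01199023, doi:10.1007/bf01614132, doi:10.1007/bf02099293, doi:10.1017/s002190020004047x, Bernardin2]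

Barriers (technique_class: odd-sector-macro-ergodicity, window-compactness, Fekete): - technique_class: odd-sector-macro-ergodicity, window-compactness, Fekete
- Literature.Barriers.AtomisticToContinuum.MacroErgodicityBarrier: engaged head-on, half evaded —
the route CONSUMES only the odd sector of the barrier's open input (ZeroCurrentRigidity, strictly
weaker than MacroErgodicityHypothesis, singled out by the barrier's own scope_caveats as what the
PINNED chain needs at Euler scale) and never meets the second half (one- /two-block estimates, sector
condition, SectorCondition.eq_zero_of_symm_zero) because no hydrodynamic limit is taken: compactness
+ parity reach the rung, superadditivity (not a closure equation) reaches κ. Honest: the rigidity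
itself is not evaded; the bet is that the odd sector is provable where the full characterisation is
not.
- Literature.Barriers.AtomisticToContinuum.HasBoundedResponse: not assumed and not attacked by a
fixed-N tool — the rung gives only D_N = o(N); boundedness and convergence of D_N are manufactured
by the imported three-length comparison (SuperadditiveResistance + Fekete), whose only fixed-N
ingredient would be one certified N₀, replaced here by the rigidity half for all T at once.
- Literature.Barriers.AtomisticToContinuum.HarmonicChainBallisticFlux: consistent and used as
calibration — at lam = β = 0 NessTightness, NessRegularity, UniformLinearRegime and
SuperadditiveResistance hold while ZeroCurrentRigidity / LiouvilleForHeat / the rung fail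
(SpohnLebowitz1977 radiating states; ballistic branch of the junction dicho

History (route lifecycle, newest last):
- 2026-08-26T08:25:37Z · DORMANT — reconciler: no traction for 8.4 d (last activity item-evidence-added at 2026-08-17T21:58:01Z); parked, not closed — `ledger route dormant route-AtomisticToConti (operator:999:309266)
- 2026-08-31T00:45:50Z · REACTIVATED (open) — reconciler: reactivated — activity statement-checked at 2026-08-30T23:27:57Z after parking at 2026-08-26T08:25:37Z (operator:999:1445023)

sub-problem: FouriersLaw · status: open · opened planner-plancard-AtomisticToContinuum-Fourier-d26dd41f-g2-0 2026-08-15T19:04:32Z · rev 3 · ledger route-AtomisticToContinuum-ParityLiouvilleSeed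
GENERATED by the gate from the ledger (D-0016/17). Provers cite these decls: `theorem foo : Summit.AtomisticToContinuum.FouriersLaw.Theses.ParityLiouvilleSeed.<Decl> := …` in Summits/AtomisticToContinuum/FouriersLaw/Theorems/<Name>.lean.
-/

namespace Summit.AtomisticToContinuum.FouriersLaw.Theses.ParityLiouvilleSeed

open scoped BigOperators Topology Manifold Classical MeasureTheory ProbabilityTheory Matrix InnerProductSpace ComplexConjugate ContinuousMap
open Filter Set Function TopologicalSpace MeasureTheory

attribute [summit_statement] _root_.FouriersLaw

/-- item stmt-AtomisticToContinuum-12073 · crux · rank 2 · open · by planner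
why it might fail: Regular current-carrying invariant states may exist without integrability: KAM/breather families (FFL1994 p.215) or a hidden quasi-local odd conserved charge (Mazur); open for every anharmonic chain; regularity alone does not kill currents (harmonic case).
sources: FritzFunakiLebowitz1994, Bernardin2014, SpohnLebowitz1977, LiveraniOlla1996, Mazur1969
[support] ZERO-CURRENT (ODD-SECTOR) RIGIDITY OF THE INFINITE CHAIN — the rigidity input of
LocalOhm's planned split and the line's kill test (a); NOT consumed by `closes` (re-ranked from crux
to support after the gen-0 review). For ω₂, lam, β > 0 (γ inert), every probability measure ν on
(ℝ×ℝ)^ℤ that is shift-invariant, time-invariant for the infinite deterministic pinned chain in the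
generator sense (∫𝒜f dν = 0, f ∈ C₀¹, 𝒜f ν-integrable) and regular (box relative entropy ≤ C|Λ|
w.r.t. a Gibbs state) — decls IsShiftInvariant / IsTimeInvariant / IsRegular of
Literature.MathematicalPhysics.KineticTheory.InfiniteChainInvariantStates (fact-free vocabulary) —
and integrates j_0 = bondCurrentZ σ 0, has ∫ j_0 dν = 0. Verbatim the consequent of
CurrentTiltQuench.OddRigidityTransfer (so a proof of CurrentTiltQuench.BoundedOddRigidity closes
it); strictly weaker than MacroErgodicityHypothesis (odd sector only); false at lam = β = 0
(SpohnLebowitz1977). Open problem; idle provers should NOT start here. [difficulty: open-problem] -/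
@[route_item "route-AtomisticToContinuum-ParityLiouvilleSeed", crux]
def ZeroCurrentRigidity : Prop :=
  ∀ ω₂ lam β γ : ℝ, 0 < ω₂ → 0 < lam → 0 < β → ∀ ν : MeasureTheory.Measure Literature.MathematicalPhysics.KineticTheory.HeatConduction.ChainConfig, MeasureTheory.IsProbabilityMeasure ν → Literature.MathematicalPhysics.KineticTheory.HeatConduction.IsShiftInvariant ν → Literature.MathematicalPhysics.KineticTheory.HeatConduction.IsTimeInvariant (Literature.MathematicalPhysics.KineticTheory.HeatConduction.pinnedChain ω₂ lam β γ) ν → Literature.MathematicalPhysics.KineticTheory.HeatConduction.IsRegular (Literature.MathematicalPhysics.KineticTheory.HeatConduction.pinnedChain ω₂ lam β γ) ν → MeasureTheory.Integrable (fun σ => (Literature.MathematicalPhysics.KineticTheory.HeatConduction.pinnedChain ω₂ lam β γ).bondCurrentZ σ 0) ν → ∫ σ, (Literature.MathematicalPhysics.KineticTheory.HeatConduction.pinnedChain ω₂ lam β γ).bondCurrentZ σ 0 ∂ν = 0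

/-- item stmt-AtomisticToContinuum-13977 · crux · rank 3 · open · by planner
why it might fail: No N-uniform a-priori estimate exists for a Hamiltonian-bulk NESS; the entropy bound needs bulk Fisher-information control (quantitative hypoellipticity uniform in N, Villani2009 §9.2); a singular exotic weak steady state would give klDiv = ∞.
sources: Bernardin2014, EckmannPilletReyBellet1999b, BernardinOlla2005, Villani2009, BeckerMenegaki2022
[crux] N-UNIFORM REGULARITY OF THE NESS (card M2; ParityLiouville stmt-5371 with original vocabulary
names): for pinnedChain (all parameters > 0) and T_L, T_R > 0 there are T > 0, a SHIFT-INVARIANT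
infinite-volume Gibbs state μ_T and C < ∞ with H(μ|_Λ ‖ μ_T|_Λ) ≤ C(n+1) for every N, every weak
steady state μ of the N-chain and every box Λ = {a,…,a+n} ⊆ {0,…,N−1}. Makes window limits regular,
i.e. inside the scope of macro-ergodicity. [difficulty: XL] -/
@[route_item "route-AtomisticToContinuum-ParityLiouvilleSeed", crux]
def NessRegularity : Prop :=
  ∀ ω₂ lam β γ : ℝ, 0 < ω₂ → 0 < lam → 0 < β → 0 < γ → ∀ T_L T_R : ℝ, 0 < T_L → 0 < T_R → ∃ (T : ℝ) (μT : MeasureTheory.Measure Literature.MathematicalPhysics.KineticTheory.HeatConduction.ChainConfig), 0 < T ∧ (Literature.MathematicalPhysics.KineticTheory.HeatConduction.pinnedChain ω₂ lam β γ).IsChainGibbsMeasure T μT ∧ Literature.MathematicalPhysics.KineticTheory.HeatConduction.IsShiftInvariant μT ∧ ∃ C : ENNReal, C ≠ ⊤ ∧ ∀ (N : ℕ) (μ : MeasureTheory.Measure (Literature.MathematicalPhysics.KineticTheory.HeatConduction.PhaseSpace N)), (Literature.MathematicalPhysics.KineticTheory.HeatConduction.pinnedChain ω₂ lam β γ).IsSteadyState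 N T_L T_R μ → ∀ (a n : ℕ) (h : a + (n + 1) ≤ N), InformationTheory.klDiv (μ.map (fun x => fun i : Fin (n + 1) => (x.1 (Fin.castLE h (Fin.natAdd a i)), x.2 (Fin.castLE h (Fin.natAdd a i))))) (Literature.MathematicalPhysics.KineticTheory.HeatConduction.boxMarginal (a : ℤ) n μT) ≤ C * (n + 1)

/-- item stmt-AtomisticToContinuum-13978 · crux · rank 4 · open · by planner
why it might fail: No N-uniform moment bound is known for any Hamiltonian-bulk chain (Bernardin2014 §2: 'polynomial in N'); Lyapunov constants of CEHR2018 grow with N; stiff pinning heats tails (Hairer2009); pinnedChain is the borderline degree 4 = 4.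
sources: Bernardin2014, CuneoEckmannHairerReyBellet2018, Hairer2009, HairerMattingly2009, EckmannPilletReyBellet1999b
[crux] N- AND SITE-UNIFORM MOMENT BOUNDS (card M1; identical to
SingleThermostatRigidity/ParityLiouville stmt-3257): for all parameters > 0, T_L, T_R > 0 and every
m there is C with ∫(|q_i|^m + |p_i|^m) dμ ≤ C for every N, every weak steady state μ of the N-chain
and every site i. Supplies tightness and uniform integrability (cubic forces, quartic currents) for
WindowLimit. [difficulty: L] -/
@[route_item "route-AtomisticToContinuum-ParityLiouvilleSeed", crux]
def NessTightness : Prop :=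
  ∀ ω₂ lam β γ : ℝ, 0 < ω₂ → 0 < lam → 0 < β → 0 < γ → ∀ T_L T_R : ℝ, 0 < T_L → 0 < T_R → ∀ m : ℕ, ∃ C : ℝ, ∀ (N : ℕ) (μ : MeasureTheory.Measure (Literature.MathematicalPhysics.KineticTheory.HeatConduction.PhaseSpace N)), (Literature.MathematicalPhysics.KineticTheory.HeatConduction.pinnedChain ω₂ lam β γ).IsSteadyState N T_L T_R μ → ∀ i : Fin N, MeasureTheory.Integrable (fun x => |x.1 i| ^ m + |x.2 i| ^ m) μ ∧ ∫ x, (|x.1 i| ^ m + |x.2 i| ^ m) ∂μ ≤ C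

/-- item stmt-AtomisticToContinuum-13979 · crux · rank 5 · open · by planner
why it might fail: Fails iff the linear regime shrinks with N (conductance a function of Nδ: a bias-generated mean free path ~1/δ, as at T→0); nonlinear response does scale with N at large bias (He–Ai–Chan–Hu 2010, NDTR); no N-uniform bound on any NESS response exists.
sources: doi:10.1103/physreve.81.041131, KunduDharNarayan2009, BonettoLebowitzReyBellet2000, arXiv:2604.00777
[crux] N-UNIFORM LINEAR REGIME OF THE PER-BOND CURRENT (new; the bridge from fixed bias to BLR's δ →
0 first, stated in the weakest form `closes` needs): under weak-NESS uniqueness, for every steady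
family, T > 0 and response coefficients D_N: ∀ ε > 0 ∃ δ₀ > 0 such that for every 0 < δ < δ₀, for
all sufficiently large N (threshold may depend on δ), |totalCurrent(μ_{N,T+δ/2,T−δ/2})/δ − D_N| ≤ εN
— i.e. lim_{δ↓0} limsup_N |J̃_N(δ)/δ − G_N| = 0 with G_N = D_N/(N−1) the conductance: the large-N
nonlinear defect of the per-bond current vanishes with the bias. Diffusive picture: the defect is
O(δ²/N) (J̃_N ≈ N⁻¹∫_{T−δ/2}^{T+δ/2}κ, odd in δ); ballistic member: exactly 0. With the rung it
gives NonBallistic (stmt-2192) inside `closes`. [difficulty: L] -/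
@[route_item "route-AtomisticToContinuum-ParityLiouvilleSeed", crux]
def UniformLinearRegime : Prop :=
  ∀ ω₂ lam β γ : ℝ, 0 < ω₂ → 0 < lam → 0 < β → 0 < γ → (∀ (N : ℕ) (T_L T_R : ℝ), 0 < T_L → 0 < T_R → ∀ μ ν : MeasureTheory.Measure (Literature.MathematicalPhysics.KineticTheory.HeatConduction.PhaseSpace N), (Literature.MathematicalPhysics.KineticTheory.HeatConduction.pinnedChain ω₂ lam β γ).IsSteadyState N T_L T_R μ → (Literature.MathematicalPhysics.KineticTheory.HeatConduction.pinnedChain ω₂ lam β γ).IsSteadyState N T_L T_R ν → μ = ν) → ∀ μ : (N : ℕ) → ℝ → ℝ → MeasureTheory.Measure (Literature.MathematicalPhysics.KineticTheory.HeatConduction.PhaseSpace N), (∀ (N : ℕ) (T_L T_R : ℝ), 0 < T_L → 0 < T_R → (Literature.MathematicalPhysics.KineticTheory.HeatConduction.pinnedChain ω₂ lam β γ).IsSteadyState N T_L T_R (μ N T_L T_R)) → ∀ T : ℝ, 0 < T → ∀ D : ℕ → ℝ, (∀ N : ℕ, Filter.Tendsto (fun δ : ℝ => (Literature.MathematicalPhysics.KineticTheory.HeatConduction.pinnedChain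 ω₂ lam β γ).totalCurrent (μ N (T + δ / 2) (T - δ / 2)) / δ) (nhdsWithin 0 {(0 : ℝ)}ᶜ) (nhds (D N))) → ∀ ε : ℝ, 0 < ε → ∃ δ₀ : ℝ, 0 < δ₀ ∧ ∀ δ : ℝ, 0 < δ → δ < δ₀ → ∀ᶠ N : ℕ in Filter.atTop, |(Literature.MathematicalPhysics.KineticTheory.HeatConduction.pinnedChain ω₂ lam β γ).totalCurrent (μ N (T + δ / 2) (T - δ / 2)) / δ - D N| ≤ ε * (N : ℝ)

/-- item stmt-AtomisticToContinuum-11748 · crux · rank 6 · SPLIT (gen 1) into EvenDoubling, QuasiSubadditiveResistance + glue SuperadditiveResistance_of_subs · direct attempts still welcome (low priority) · by planner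
why it might fail: Junction-repair cost may grow with N, M if optimal response fields carry junction-crossing coherent structure at all scales (long mean free path; C(T)↑∞ as T→0 must be allowed); no sign principle is known; fails exactly for superdiffusive transport.
sources: GaudilliereLandim2013, LandimMarianiSeo2018, arXiv:1105.0493, ReyBellet2003, Buttiker1986, Hammersley1988
[crux] under weak-NESS uniqueness, for every steady-state family of pinnedChain ω₂ lam β γ (all >
0), every T > 0 and response coefficients D_N > 0 (N ≥ 2): ∃ C = C(ω₂,lam,β,γ,T) with R_{N+M} ≥ R_N
+ R_M − C for all N, M ≥ 2, R_N := (N−1)/D_N (card item K1; = InsertionCost of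
insertion-cost-superadditive-half). Bounded reservoir-insertion cost: cutting the chain and
re-thermalising the cut raises the end-to-end resistance by at most a contact constant. Arena:
Dirichlet/Thomson saddle representation of D_N for L = A_H + γS_baths + a junction-repair lemma
gluing near-optimal admissible pairs of the two bathed halves across the deterministic bond at cost
≤ C uniformly in N, M (admissible classes are bulk-invariant, arXiv:1105.0493 §6); other engines:
thermostat interpolation at the junction, contact cross-correlations. NOT implied by FouriersLaw (it
carries the 1/N rate): the bet. Trivial at lam = β = 0 (HarmonicCalibration). [difficulty: XL] -/
@[route_item "route-AtomisticToContinuum-ParityLiouvilleSeed", crux]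
def SuperadditiveResistance : Prop :=
  ∀ ω₂ lam β γ : ℝ, 0 < ω₂ → 0 < lam → 0 < β → 0 < γ → (∀ (N : ℕ) (T_L T_R : ℝ), 0 < T_L → 0 < T_R → ∀ μ ν : MeasureTheory.Measure (Literature.MathematicalPhysics.KineticTheory.HeatConduction.PhaseSpace N), (Literature.MathematicalPhysics.KineticTheory.HeatConduction.pinnedChain ω₂ lam β γ).IsSteadyState N T_L T_R μ → (Literature.MathematicalPhysics.KineticTheory.HeatConduction.pinnedChain ω₂ lam β γ).IsSteadyState N T_L T_R ν → μ = ν) → ∀ μ : (N : ℕ) → ℝ → ℝ → MeasureTheory.Measure (Literature.MathematicalPhysics.KineticTheory.HeatConduction.PhaseSpace N), (∀ (N : ℕ) (T_L T_R : ℝ), 0 < T_L → 0 < T_R → (Literature.MathematicalPhysics.KineticTheory.HeatConduction.pinnedChain ω₂ lam β γ).IsSteadyState N T_L T_R (μ N T_L T_R)) → ∀ T : ℝ, 0 < T → ∀ D : ℕ → ℝ, (∀ N : ℕ, Filter.Tendsto (fun δ : ℝ => (Literature.MathematicalPhysics.KineticTheory.HeatConduction.pinnedChain ω₂ lam β γ).totalCurrent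 (μ N (T + δ / 2) (T - δ / 2)) / δ) (nhdsWithin 0 {(0 : ℝ)}ᶜ) (nhds (D N))) → (∀ N : ℕ, 2 ≤ N → 0 < D N) → ∃ C : ℝ, ∀ N M : ℕ, 2 ≤ N → 2 ≤ M → ((N : ℝ) - 1) / D N + ((M : ℝ) - 1) / D M - C ≤ ((N : ℝ) + (M : ℝ) - 1) / D (N + M)

-- parent: SuperadditiveResistance · child (gen 1)
/--     item stmt-AtomisticToContinuum-19939 · crux · rank 601 · open
    parent: SuperadditiveResistance · by operator
    why it might fail: Non-summable dyadic creep of κ_N from below (log/power) kills it (Negative.KillCriteria not_insertionBounded_of_doubling_excess); real at the lam = 0 edge and in the exchange-noise proxy (Disproof §4(iii), §6); for lam > 0 no N-uniform long-wave scattering engine exists in tree or print.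
    sources: BonettoLebowitzReyBellet2000, AokiKusnezov2001, LepriLiviPoliti2003, ReyBellet2003, KunduDharNarayan2009, Hammersley1988
[crux] BOUNDED DOUBLING DEFECT — SuperadditiveResistance on its diagonal N = M: under weak-NESS
uniqueness, for every steady-state family of pinnedChain ω₂ lam β γ (all > 0), every T > 0 and
response coefficients D_N > 0 (N ≥ 2): ∃ C₁(ω₂,lam,β,γ,T) with 2R_N − C₁ ≤ R_{2N} for all N ≥ 2, R_N
:= (N−1)/D_N. The one junction comparison carrying the exact ℤ₂ symmetry i ↦ 2N−1−i, δ ↦ −δ.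
NECESSARY for SuperadditiveResistance (DiagonalSplit.evenDoubling_of_superadditiveResistance,
p150360), not sufficient alone (Negative.KillCriteria doubling_not_sufficient;
Negative.DyadicDoublingNotSufficient p163747/p163897); WITH
FeketeSeriesLaw.QuasiSubadditiveResistance (stmt-AtomisticToContinuum-14041) it gives
SuperadditiveResistance with constant 2C₁ + C₂ (DiagonalSplit.superadditiveResistance_of_subs,
p150360). Hypothesis-free equilibrium form: ∃ C ∀ N ≥ 2 ∀ plain forward fields g_N, g_2N, 2/G_N − C
≤ 1/G_2N (evenDoubling_iff_kuboDoublingBound, p150384); modulo the floor stmt-11749 it follows from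
the dyadic conductivity increment D_{2N} − D_N ≤ C/N
(DyadicIncrement.evenDoubling_of_increment_of_floor, p157807). Still an N-uniform transport estimate
for the deterministic pinned anharmonic chain ( -/
@[route_item "route-AtomisticToContinuum-ParityLiouvilleSeed"]
def EvenDoubling : Prop :=
  ∀ ω₂ lam β γ : ℝ, 0 < ω₂ → 0 < lam → 0 < β → 0 < γ → (∀ (N : ℕ) (T_L T_R : ℝ), 0 < T_L → 0 < T_R → ∀ μ ν : MeasureTheory.Measure (Literature.MathematicalPhysics.KineticTheory.HeatConduction.PhaseSpace N), (Literature.MathematicalPhysics.KineticTheory.HeatConduction.pinnedChain ω₂ lam β γ).IsSteadyState N T_L T_R μ → (Literature.MathematicalPhysics.KineticTheory.HeatConduction.pinnedChain ω₂ lam β γ).IsSteadyState N T_L T_R ν → μ = ν) → ∀ μ : (N : ℕ) → ℝ → ℝ → MeasureTheory.Measure (Literature.MathematicalPhysics.KineticTheory.HeatConduction.PhaseSpace N), (∀ (N : ℕ) (T_L T_R : ℝ), 0 < T_L → 0 < T_R → (Literature.MathematicalPhysics.KineticTheory.HeatConduction.pinnedChain ω₂ lam β γ).IsSteadyState N T_L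 T_R (μ N T_L T_R)) → ∀ T : ℝ, 0 < T → ∀ D : ℕ → ℝ, (∀ N : ℕ, Filter.Tendsto (fun δ : ℝ => (Literature.MathematicalPhysics.KineticTheory.HeatConduction.pinnedChain ω₂ lam β γ).totalCurrent (μ N (T + δ / 2) (T - δ / 2)) / δ) (nhdsWithin 0 {(0 : ℝ)}ᶜ) (nhds (D N))) → (∀ N : ℕ, 2 ≤ N → 0 < D N) → ∃ C : ℝ, ∀ N : ℕ, 2 ≤ N → 2 * (((N : ℝ) - 1) / D N) - C ≤ ((N : ℝ) + (N : ℝ) - 1) / D (N + N)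

-- parent: SuperadditiveResistance · child (gen 1)
/--     item stmt-AtomisticToContinuum-14041 · crux · rank 602 · open
    parent: SuperadditiveResistance · by planner
    why it might fail: Joining two bathed halves could conduct worse than their series composition by an unbounded amount if the contact resistance of a bathed end grew with the length behind it; excluded in the proxy beds (Disproof §6) and at lam = 0, but for lam > 0 the N-uniform junction bound is the missing engine.
    sources: BonettoLebowitzReyBellet2000, AokiKusnezov2001, Hammersley1988, LepriLiviPoliti2003
[crux] card crux 1 (series law with bounded junction defect). For pinnedChain ω₂ lam β γ (all > 0),
under weak-NESS uniqueness, for every steady-state family μ, every T > 0 and response coefficients D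
(the δ-limits of clause (ii)): ∃ C ∀ N, M ≥ 2, (N+M−1)/D_{N+M} ≤ (N−1)/D_N + (M−1)/D_M + C, i.e.
R_{N+M} ≤ R_N + R_M + C for the bath-to-bath resistance R_N = (N−1)/D_N = 1/G_N. Calibration: holds
for the harmonic member (R_N = 1/c_N bounded, HarmonicChainBallisticFlux) and for the diffusive
phenomenology R_N = 2r_b + (N−1)/κ (LepriLiviPoliti2003 §6, AokiKusnezov2001: affine ⇒ defect ≤ 0).
[difficulty: XL] -/
@[route_item "route-AtomisticToContinuum-ParityLiouvilleSeed"]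
def QuasiSubadditiveResistance : Prop :=
  ∀ ω₂ lam β γ : ℝ, 0 < ω₂ → 0 < lam → 0 < β → 0 < γ → (∀ (N : ℕ) (T_L T_R : ℝ), 0 < T_L → 0 < T_R → ∀ μ ν : MeasureTheory.Measure (Literature.MathematicalPhysics.KineticTheory.HeatConduction.PhaseSpace N), (Literature.MathematicalPhysics.KineticTheory.HeatConduction.pinnedChain ω₂ lam β γ).IsSteadyState N T_L T_R μ → (Literature.MathematicalPhysics.KineticTheory.HeatConduction.pinnedChain ω₂ lam β γ).IsSteadyState N T_L T_R ν → μ = ν) → ∀ μ : (N : ℕ) → ℝ → ℝ → MeasureTheory.Measure (Literature.MathematicalPhysics.KineticTheory.HeatConduction.PhaseSpace N), (∀ (N : ℕ) (T_L T_R : ℝ), 0 < T_L → 0 < T_R → (Literature.MathematicalPhysics.KineticTheory.HeatConduction.pinnedChain ω₂ lam β γ).IsSteadyState N T_L T_R (μ N T_L T_R)) → ∀ T : ℝ, 0 < T → ∀ D : ℕ → ℝ, (∀ N : ℕ, Filter.Tendsto (fun δ : ℝ => (Literature.MathematicalPhysics.KineticTheory.HeatConduction.pinnedChain ω₂ lam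 β γ).totalCurrent (μ N (T + δ / 2) (T - δ / 2)) / δ) (nhdsWithin 0 {(0 : ℝ)}ᶜ) (nhds (D N))) → ∃ C : ℝ, ∀ N M : ℕ, 2 ≤ N → 2 ≤ M → ((N + M - 1 : ℕ) : ℝ) / D (N + M) ≤ ((N - 1 : ℕ) : ℝ) / D N + ((M - 1 : ℕ) : ℝ) / D M + C

-- parent: SuperadditiveResistance · glue (gen 1)
/--     item stmt-AtomisticToContinuum-19940 · support · rank 603 · open
    parent: SuperadditiveResistance · GLUE: children ⟹ parent · by operator
EvenDoubling → QuasiSubadditiveResistance → SuperadditiveResistance: Fekete lower envelope from the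
series law + dyadic upper envelope from bounded doubling ⇒ insertion defect ≤ 2C₁ + C₂. PROVED and
landed as
Summit.AtomisticToContinuum.FouriersLaw.Theorems.SuperadditiveResistance.DiagonalSplit.superadditiveResistance_of_subs
(p150360, Theorems/JunctionLocalitySuperadditiveResistanceDiagonalSplit.lean; its binder types are
these children verbatim, FeketeSeriesLaw.QuasiSubadditiveResistance being Iff.rfl-equal to child 2)
— a prover closes this glue item by exact-ing that theorem (it cannot be linked with --glue-by
because its module imports this Theses file). -/
@[route_item "route-AtomisticToContinuum-ParityLiouvilleSeed"]
def SuperadditiveResistance_of_subs : Prop :=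
  EvenDoubling → QuasiSubadditiveResistance → SuperadditiveResistance

/-- item stmt-AtomisticToContinuum-0717 · support · rank 9 · closed · proved by Summit.AtomisticToContinuum.FouriersLaw.Theorems.FourierGreenKubo.finiteResponseOfUnique_holds (prover) · by planner
sources: ReyBellet2003, HairerMajda2009, CuneoEckmannHairerReyBellet2018
CONDITIONAL FORM OF 0705 (supersedes it as the prover target; refuters pool-5/g3-0: 0705 stand-alone
quantifies over EVERY steady-state family and is false-prone if weak steady states were non-unique):
assuming UNIQUENESS of weak steady states (IsSteadyState class) for pinnedChain at all N, T_L, T_R >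
0, the finite-N linear-response limit D_N(T) = lim_{δ→0, δ≠0} totalCurrent(μ_{N,T+δ/2,T−δ/2})/δ
exists for every T > 0 and N. Content: differentiability at equilibrium of NESS expectations of the
polynomial currents in the bath temperatures (ReyBellet2003 arXiv:math-ph/0303021 Rem 4.4 (51)–(56)
finite-volume Green–Kubo; HairerMajda2009 arXiv:0909.4313 Thm 2.3 framework — their SDE Thm 4.4
Assumption 5 fails here, so verify Assumptions 1–3 via CEHR2018 (2.5)/Carmona2007 Thm 1.1(iv)
weighted spectral gap). N = 0, 1: totalCurrent ≡ 0, D = 0. Together with 0706 gives 0705. -/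
@[route_item "route-AtomisticToContinuum-ParityLiouvilleSeed", crux]
def FiniteResponseOfUnique : Prop :=
  ∀ ω₂ lam β γ : ℝ, 0 < ω₂ → 0 < lam → 0 < β → 0 < γ → (∀ (N : ℕ) (T_L T_R : ℝ), 0 < T_L → 0 < T_R → ∀ μ ν : MeasureTheory.Measure (Literature.MathematicalPhysics.KineticTheory.HeatConduction.PhaseSpace N), (Literature.MathematicalPhysics.KineticTheory.HeatConduction.pinnedChain ω₂ lam β γ).IsSteadyState N T_L T_R μ → (Literature.MathematicalPhysics.KineticTheory.HeatConduction.pinnedChain ω₂ lam β γ).IsSteadyState N T_L T_R ν → μ = ν) → ∀ μ : (N : ℕ) → ℝ → ℝ → MeasureTheory.Measure (Literature.MathematicalPhysics.KineticTheory.HeatConduction.PhaseSpace N), (∀ (N : ℕ) (T_L T_R : ℝ), 0 < T_L → 0 < T_R → (Literature.MathematicalPhysics.KineticTheory.HeatConduction.pinnedChain ω₂ lam β γ).IsSteadyState N T_L T_R (μ N T_L T_R)) → ∀ T : ℝ, 0 < T → ∀ N : ℕ, ∃ D : ℝ, Filter.Tendsto (fun δ : ℝ => (Literature.MathematicalPhysics.KineticTheory.HeatConduction.pinnedChain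 ω₂ lam β γ).totalCurrent (μ N (T + δ / 2) (T - δ / 2)) / δ) (nhdsWithin 0 {(0 : ℝ)}ᶜ) (nhds D)

/-- `FiniteResponseOfUnique` holds: proved by `Summit.AtomisticToContinuum.FouriersLaw.Theorems.FourierGreenKubo.finiteResponseOfUnique_holds`. -/
theorem FiniteResponseOfUnique_holds : FiniteResponseOfUnique := _root_.Summit.AtomisticToContinuum.FouriersLaw.Theorems.FourierGreenKubo.finiteResponseOfUnique_holds

/-- item stmt-AtomisticToContinuum-0741 · support · rank 9 · closed · proved by Summit.AtomisticToContinuum.FouriersLaw.Theorems.nessUnique_proof (prover) · by planner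
sources: CuneoEckmannHairerReyBellet2018, Carmona2007
[crux] UNIQUENESS OF THE WEAK STEADY STATE (the half of stmt-0706 not covered by the landed fact
Literature.MathematicalPhysics.KineticTheory.HeatConduction.CuneoEckmannHairerReyBellet2018_pinnedChain,
p3544): for pinnedChain ω₂ lam β γ (all > 0), every N and T_L, T_R > 0, any two measures in the weak
Fokker–Planck class IsSteadyState (probability, ∫ L f dμ = 0 for f ∈ C_c^∞, bond currents
integrable) coincide. Print: uniqueness of the INVARIANT MEASURE of the Langevin semigroup
(CuneoEckmannHairerReyBellet2018 Thm 2.13(1): C1, C2, CA; Carmona2007 Thm 1.1(iii)); the item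
additionally needs 'weak stationary probability solution of L*μ = 0 ⇒ P_t-invariant' for this
hypoelliptic L with cubic drift (Echeverría 1982 well-posed martingale problem on C_c^∞ +
non-explosion via e^{θH}; Bogachev–Krylov–Röckner–Shaposhnikov 2015 Ch. 5 is non-degenerate only) —
the FP-identification lemma is the formal crux. N = 0: PhaseSpace 0 is a point (unique probability
measure); N = 1: both baths on site 0, OU at temperature (T_L+T_R)/2. This is exactly the hypothesis
of FiniteResponse and ThermodynamicLimit and, with the fact, gives clause (i) of FouriersLawFor. -/
@[route_item "route-AtomisticToContinuum-ParityLiouvilleSeed", crux]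
def NessUnique : Prop :=
  ∀ ω₂ lam β γ : ℝ, 0 < ω₂ → 0 < lam → 0 < β → 0 < γ → ∀ (N : ℕ) (T_L T_R : ℝ), 0 < T_L → 0 < T_R → ∀ μ ν : MeasureTheory.Measure (Literature.MathematicalPhysics.KineticTheory.HeatConduction.PhaseSpace N), (Literature.MathematicalPhysics.KineticTheory.HeatConduction.pinnedChain ω₂ lam β γ).IsSteadyState N T_L T_R μ → (Literature.MathematicalPhysics.KineticTheory.HeatConduction.pinnedChain ω₂ lam β γ).IsSteadyState N T_L T_R ν → μ = ν

/-- `NessUnique` holds: proved by `Summit.AtomisticToContinuum.FouriersLaw.Theorems.nessUnique_proof`. -/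
theorem NessUnique_holds : NessUnique := _root_.Summit.AtomisticToContinuum.FouriersLaw.Theorems.nessUnique_proof

/-- item stmt-AtomisticToContinuum-11749 · support · rank 9 · open · by planner
sources: DeRoeckHuveneers2015, BernardinOlla2005, BasileBernardinOlla2009, BonettoLebowitzReyBellet2000
[crux] under weak-NESS uniqueness, for every steady-state family of pinnedChain ω₂ lam β γ (all >
0), T > 0 and the response coefficients D_N: ∃ c = c(ω₂,lam,β,γ,T) > 0 and N₁ with D_N ≥ c for all N
≥ N₁ (liminf_N D_N > 0; an Ohmic LOWER bound J_N ≥ c·δT/(N−1) to first order; card item K3's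
positivity half). NECESSARY for the conjunct (D_N → κ(T) > 0). In the glue it caps the Fekete slope
(R_N/N ≤ 1/c), i.e. κ ≥ c. No N-uniform lower bound on the NESS current of a deterministic
anharmonic chain is in print; candidate engines: linear-response fluctuation-theorem / uncertainty
bounds, comparison with the energy-conserving-noise chain where κ ≥ c is a theorem
(BernardinOlla2005, BasileBernardinOlla2009), multi-scale pigeonhole on the response temperature
profile (card anti-insulator-kink-rigidity); ALTERNATIVE SUPPLIER: the companion SUBadditive half
(card fekete-resistance-subadditivity: R_{N+M} ≤ R_N + R_M + C' and D_2 > 0 give R_N ≤ K·N, hence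
D_N ≥ 1/(2K)). [difficulty: XL] -/
@[route_item "route-AtomisticToContinuum-ParityLiouvilleSeed", crux]
def ConductanceLowerBound : Prop :=
  ∀ ω₂ lam β γ : ℝ, 0 < ω₂ → 0 < lam → 0 < β → 0 < γ → (∀ (N : ℕ) (T_L T_R : ℝ), 0 < T_L → 0 < T_R → ∀ μ ν : MeasureTheory.Measure (Literature.MathematicalPhysics.KineticTheory.HeatConduction.PhaseSpace N), (Literature.MathematicalPhysics.KineticTheory.HeatConduction.pinnedChain ω₂ lam β γ).IsSteadyState N T_L T_R μ → (Literature.MathematicalPhysics.KineticTheory.HeatConduction.pinnedChain ω₂ lam β γ).IsSteadyState N T_L T_R ν → μ = ν) → ∀ μ : (N : ℕ) → ℝ → ℝ → MeasureTheory.Measure (Literature.MathematicalPhysics.KineticTheory.HeatConduction.PhaseSpace N), (∀ (N : ℕ) (T_L T_R : ℝ), 0 < T_L → 0 < T_R → (Literature.MathematicalPhysics.KineticTheory.HeatConduction.pinnedChain ω₂ lam β γ).IsSteadyState N T_L T_R (μ N T_L T_R)) → ∀ T : ℝ, 0 < T → ∀ D : ℕ → ℝ, (∀ N : ℕ, Filter.Tendsto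 (fun δ : ℝ => (Literature.MathematicalPhysics.KineticTheory.HeatConduction.pinnedChain ω₂ lam β γ).totalCurrent (μ N (T + δ / 2) (T - δ / 2)) / δ) (nhdsWithin 0 {(0 : ℝ)}ᶜ) (nhds (D N))) → ∃ c : ℝ, 0 < c ∧ ∃ N₁ : ℕ, ∀ N : ℕ, N₁ ≤ N → c ≤ D N

/-- item stmt-AtomisticToContinuum-11750 · support · rank 9 · closed · proved by Summit.AtomisticToContinuum.FouriersLaw.Cruxes.BoundedResponseConverges.TwoScaleGluingLogRigidity.Stubs.positiveConductance_holds (prover) · by planner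
sources: ReyBellet2003, KunduDharNarayan2009, EckmannPilletReyBellet1999b
[support] POSITIVE CONDUCTANCE AT EVERY FINITE LENGTH (fixed-N analysis): under weak-NESS
uniqueness, for every steady-state family, T > 0 and response coefficients D, D_N(T) > 0 for all N ≥
2. Content: the finite-volume Kubo / fluctuation formula D_N = (N−1)T⁻² ∫₀^∞ ⟨j_b(0) Σ_i j_i(t)⟩_eq
dt = lim_t Var(Q_t)/(2tT²) ≥ 0 (ReyBellet2003 Rem 4.4 (56); KunduDharNarayan2009 for Langevin baths)
is NON-DEGENERATE — the time-integrated boundary energy current is not an L²-coboundary of the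
equilibrium dynamics; equivalently strict positivity of entropy production at T_L ≠ T_R
(EckmannPilletReyBellet1999b) survives at first order in δT. Needed so that R_N = (N−1)/D_N is a
resistance in (A) and in the Fekete step. Fixed-N toolbox: CuneoEckmannHairerReyBellet2018 Thm 2.13,
Carmona2007, HairerMajda2009. [difficulty: M] -/
@[route_item "route-AtomisticToContinuum-ParityLiouvilleSeed", crux]
def PositiveConductance : Prop :=
  ∀ ω₂ lam β γ : ℝ, 0 < ω₂ → 0 < lam → 0 < β → 0 < γ → (∀ (N : ℕ) (T_L T_R : ℝ), 0 < T_L → 0 < T_R → ∀ μ ν : MeasureTheory.Measure (Literature.MathematicalPhysics.KineticTheory.HeatConduction.PhaseSpace N), (Literature.MathematicalPhysics.KineticTheory.HeatConduction.pinnedChain ω₂ lam β γ).IsSteadyState N T_L T_R μ → (Literature.MathematicalPhysics.KineticTheory.HeatConduction.pinnedChain ω₂ lam β γ).IsSteadyState N T_L T_R ν → μ = ν) → ∀ μ : (N : ℕ) → ℝ → ℝ → MeasureTheory.Measure (Literature.MathematicalPhysics.KineticTheory.HeatConduction.PhaseSpace N), (∀ (N : ℕ) (T_L T_R : ℝ),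 0 < T_L → 0 < T_R → (Literature.MathematicalPhysics.KineticTheory.HeatConduction.pinnedChain ω₂ lam β γ).IsSteadyState N T_L T_R (μ N T_L T_R)) → ∀ T : ℝ, 0 < T → ∀ D : ℕ → ℝ, (∀ N : ℕ, Filter.Tendsto (fun δ : ℝ => (Literature.MathematicalPhysics.KineticTheory.HeatConduction.pinnedChain ω₂ lam β γ).totalCurrent (μ N (T + δ / 2) (T - δ / 2)) / δ) (nhdsWithin 0 {(0 : ℝ)}ᶜ) (nhds (D N))) → ∀ N : ℕ, 2 ≤ N → 0 < D N

/-- `PositiveConductance` holds: proved by `Summit.AtomisticToContinuum.FouriersLaw.Cruxes.BoundedResponseConverges.TwoScaleGluingLogRigidity.Stubs.positiveConductance_holds`. -/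
theorem PositiveConductance_holds : PositiveConductance := _root_.Summit.AtomisticToContinuum.FouriersLaw.Cruxes.BoundedResponseConverges.TwoScaleGluingLogRigidity.Stubs.positiveConductance_holds

/-- item stmt-AtomisticToContinuum-11751 · support · rank 9 · closed · proved by Summit.AtomisticToContinuum.FouriersLaw.Theorems.superadditiveFekete_proof @ f6a0316892c1 (prover) · by planner
sources: Hammersley1988
[support] FEKETE GLUE (pure real analysis), PROVED sorry-free in the planner folder (Fekete.lean,
theorem superadditiveFekete_holds, axioms propext/Classical.choice/Quot.sound, ~170 lines; attached
as evidence — copy into Theorems/): for a real sequence D with D_N > 0 (N ≥ 2), eventually D_N ≥ c >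
0, resistances R_N := (N−1)/D_N superadditive up to the constant C on {N, M ≥ 2}, and D_N ≤ ε(N−1)
frequently for every ε > 0, the sequence D converges to some κ > 0. Proof: a_N := R_N − C satisfies
a_{N+M} ≥ a_N + a_M (N, M ≥ 2); k·a_n + a_r ≤ a_{kn+r} (n, r ≥ 2) along each residue class gives
liminf a_N/N ≥ a_n/n, so a_N/N → ℓ := sup_{n≥2} a_n/n (bounded above by 1/c + |C| beyond N₁,
finitely many before); non-ballisticity with ε = 1/(|C|+1) gives some a_{N₀} > 0, so ℓ > 0; then
R_N/N → ℓ and D_N = ((N−1)/N)/(R_N/N) → 1/ℓ =: κ > 0. It is the hypothesis hF of `closes`.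
[difficulty: provable-now] -/
@[route_item "route-AtomisticToContinuum-ParityLiouvilleSeed", crux]
def SuperadditiveFekete : Prop :=
  ∀ (D : ℕ → ℝ) (C c : ℝ), 0 < c → (∀ N : ℕ, 2 ≤ N → 0 < D N) → (∃ N₁ : ℕ, ∀ N : ℕ, N₁ ≤ N → c ≤ D N) → (∀ N M : ℕ, 2 ≤ N → 2 ≤ M → ((N : ℝ) - 1) / D N + ((M : ℝ) - 1) / D M - C ≤ ((N : ℝ) + (M : ℝ) - 1) / D (N + M)) → (∀ ε : ℝ, 0 < ε → ∀ N₀ : ℕ, ∃ N : ℕ, N₀ ≤ N ∧ D N ≤ ε * ((N : ℝ) - 1)) → ∃ κ : ℝ, 0 < κ ∧ Filter.Tendsto D Filter.atTop (nhds κ)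

/-- `SuperadditiveFekete` holds: proved by `Summit.AtomisticToContinuum.FouriersLaw.Theorems.superadditiveFekete_proof` @ f6a0316892c1. -/
theorem SuperadditiveFekete_holds : SuperadditiveFekete := _root_.Summit.AtomisticToContinuum.FouriersLaw.Theorems.superadditiveFekete_proof

/-- item stmt-AtomisticToContinuum-13980 · support · rank 9 · open · by planner
sources: SpohnLebowitz1977, FritzFunakiLebowitz1994, Bernardin2014
[support] LIOUVILLE THEOREM FOR HEAT (card M3, the stand-alone deliverable; ParityLiouville
stmt-5372 with original vocabulary names): for ω₂, lam, β > 0 every probability measure on (ℝ×ℝ)^ℤ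
that is time-invariant, translation-BOUNDED (all polynomial site moments bounded uniformly in the
site) and uniformly regular (box relative entropies ≤ C(n+1) w.r.t. one shift-invariant Gibbs
state), with j₀ integrable, has ∫ j₀ dν = 0 — shift-invariance NOT assumed. False for the harmonic
chain (SpohnLebowitz1977), printed there (§7(iii)) as an expectation for anharmonic crystals. Closed
by CesaroUpgrade + ZeroCurrentRigidity, or directly. [difficulty: open-problem] -/
@[route_item "route-AtomisticToContinuum-ParityLiouvilleSeed"]
def LiouvilleForHeat : Prop :=
  ∀ ω₂ lam β γ : ℝ, 0 < ω₂ → 0 < lam → 0 < β → ∀ ν : MeasureTheory.Measure Literature.MathematicalPhysics.KineticTheory.HeatConduction.ChainConfig, MeasureTheory.IsProbabilityMeasure ν → Literature.MathematicalPhysics.KineticTheory.HeatConduction.IsTimeInvariant (Literature.MathematicalPhysics.KineticTheory.HeatConduction.pinnedChain ω₂ lam β γ) ν → (∀ m : ℕ, ∃ C : ℝ, ∀ x : ℤ, MeasureTheory.Integrable (fun σ => |(σ x).1| ^ m + |(σ x).2| ^ m) ν ∧ ∫ σ, (|(σ x).1| ^ m + |(σ x).2| ^ m) ∂ν ≤ C)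 → (∃ (T : ℝ) (μT : MeasureTheory.Measure Literature.MathematicalPhysics.KineticTheory.HeatConduction.ChainConfig), 0 < T ∧ (Literature.MathematicalPhysics.KineticTheory.HeatConduction.pinnedChain ω₂ lam β γ).IsChainGibbsMeasure T μT ∧ Literature.MathematicalPhysics.KineticTheory.HeatConduction.IsShiftInvariant μT ∧ ∃ C : ENNReal, C ≠ ⊤ ∧ ∀ (a : ℤ) (n : ℕ), InformationTheory.klDiv (Literature.MathematicalPhysics.KineticTheory.HeatConduction.boxMarginal a n ν) (Literature.MathematicalPhysics.KineticTheory.HeatConduction.boxMarginal a n μT) ≤ C * (n + 1)) → MeasureTheory.Integrable (fun σ => (Literature.MathematicalPhysics.KineticTheory.HeatConduction.pinnedChain ω₂ lam β γ).bondCurrentZ σ 0) ν → ∫ σ, (Literature.MathematicalPhysics.KineticTheory.HeatConduction.pinnedChain ω₂ lam β γ).bondCurrentZ σ 0 ∂ν = 0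

/-- item stmt-AtomisticToContinuum-13981 · support · rank 9 · closed · proved by Summit.AtomisticToContinuum.FouriersLaw.Theorems.cesaroUpgrade_proof (prover) · by planner
sources: Bernardin2014, KipnisLandim1999, LanfordLebowitzLieb1977
[support] GLUE ZeroCurrentRigidity → LiouvilleForHeat (ParityLiouville stmt-5373; provable, ~1–2
weeks of Lean): Cesàro-average ν over shifts (time-invariance, site-uniform moments and — convexity
of klDiv in the first argument, shift-invariant reference — the regularity constant are preserved);
tightness from moments; along a subsequence a shift-invariant, time-invariant (uniform integrability
of 𝒜f from moments of order > 3), regular (l.s.c. of klDiv box by box) limit ν̄ with j₀ ∈ L¹;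
BOND-INDEPENDENCE 𝒜e_k = j_{k−1} − j_k (cut-offs, dominated convergence) gives ν(j_k) = ν(j₀) for
all k, so ν̄(j₀) = ν(j₀), which ZeroCurrentRigidity kills. [difficulty: M] -/
@[route_item "route-AtomisticToContinuum-ParityLiouvilleSeed", crux]
def CesaroUpgrade : Prop :=
  ZeroCurrentRigidity → LiouvilleForHeat

-- `CesaroUpgrade` holds: proved by `Summit.AtomisticToContinuum.FouriersLaw.Theorems.cesaroUpgrade_proof` (its module imports this route file, so no `_holds` link can be stated here).

/-- item stmt-AtomisticToContinuum-13982 · support · rank 9 · closed · proved by Summit.AtomisticToContinuum.FouriersLaw.Theorems.windowLimit_proof @ 9f6e182e6f09 (prover) · by planner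
sources: EyinkLebowitzSpohn1991, LanfordLebowitzLieb1977, KipnisLandim1999, SpohnLebowitz1977
[support] BULK WINDOW COMPACTNESS (ParityLiouville stmt-5375 with original vocabulary names;
provable, no sign conditions): for any real parameters and any family (μ_N) of weak steady states
with site-uniform moments (NessTightness shape) and uniform regularity w.r.t. a shift-invariant
Gibbs reference (NessRegularity shape), if for some ε > 0 frequently ε ≤ |totalCurrent(μ_N)/(N−1)|,
then some probability measure ν on (ℝ×ℝ)^ℤ is time-invariant, translation-bounded, uniformly regular
w.r.t. the same reference, with j₀ integrable and ε ≤ |∫ j₀ dν| (windows centred at ⌊N/2⌋,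
Prokhorov, stationarity transfer — bath terms do not touch bulk coordinates —, bond currents of a
steady state all equal J̃_N, uniform integrability from moments > 4). [difficulty: M] -/
@[route_item "route-AtomisticToContinuum-ParityLiouvilleSeed", crux]
def WindowLimit : Prop :=
  ∀ (ω₂ lam β γ T_L T_R : ℝ) (μ : (N : ℕ) → MeasureTheory.Measure (Literature.MathematicalPhysics.KineticTheory.HeatConduction.PhaseSpace N)), (∀ N, (Literature.MathematicalPhysics.KineticTheory.HeatConduction.pinnedChain ω₂ lam β γ).IsSteadyState N T_L T_R (μ N)) → (∀ m : ℕ, ∃ C : ℝ, ∀ (N : ℕ) (i : Fin N), MeasureTheory.Integrable (fun x => |x.1 i| ^ m + |x.2 i| ^ m) (μ N) ∧ ∫ x, (|x.1 i| ^ m + |x.2 i| ^ m) ∂(μ N) ≤ C) → (∃ (T : ℝ) (μT : MeasureTheory.Measure Literature.MathematicalPhysics.KineticTheory.HeatConduction.ChainConfig), 0 < T ∧ (Literature.MathematicalPhysics.KineticTheory.HeatConduction.pinnedChain ω₂ lam β γ).IsChainGibbsMeasure T μT ∧ Literature.MathematicalPhysics.KineticTheory.HeatConduction.IsShiftInvariant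 μT ∧ ∃ C : ENNReal, C ≠ ⊤ ∧ ∀ (N : ℕ) (a n : ℕ) (h : a + (n + 1) ≤ N), InformationTheory.klDiv ((μ N).map (fun x => fun i : Fin (n + 1) => (x.1 (Fin.castLE h (Fin.natAdd a i)), x.2 (Fin.castLE h (Fin.natAdd a i))))) (Literature.MathematicalPhysics.KineticTheory.HeatConduction.boxMarginal (a : ℤ) n μT) ≤ C * (n + 1)) → ∀ ε : ℝ, 0 < ε → (∃ᶠ N in Filter.atTop, ε ≤ |(Literature.MathematicalPhysics.KineticTheory.HeatConduction.pinnedChain ω₂ lam β γ).totalCurrent (μ N) / ((N : ℝ) - 1)|) → ∃ ν : MeasureTheory.Measure Literature.MathematicalPhysics.KineticTheory.HeatConduction.ChainConfig, MeasureTheory.IsProbabilityMeasure ν ∧ Literature.MathematicalPhysics.KineticTheory.HeatConduction.IsTimeInvariant (Literature.MathematicalPhysics.KineticTheory.HeatConduction.pinnedChain ω₂ lam β γ) ν ∧ (∀ m : ℕ, ∃ C : ℝ, ∀ x : ℤ, MeasureTheory.Integrable (fun σ => |(σ x).1| ^ m + |(σ x).2| ^ m) ν ∧ ∫ σ, (|(σ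 x).1| ^ m + |(σ x).2| ^ m) ∂ν ≤ C) ∧ (∃ (T : ℝ) (μT : MeasureTheory.Measure Literature.MathematicalPhysics.KineticTheory.HeatConduction.ChainConfig), 0 < T ∧ (Literature.MathematicalPhysics.KineticTheory.HeatConduction.pinnedChain ω₂ lam β γ).IsChainGibbsMeasure T μT ∧ Literature.MathematicalPhysics.KineticTheory.HeatConduction.IsShiftInvariant μT ∧ ∃ C : ENNReal, C ≠ ⊤ ∧ ∀ (a : ℤ) (n : ℕ), InformationTheory.klDiv (Literature.MathematicalPhysics.KineticTheory.HeatConduction.boxMarginal a n ν) (Literature.MathematicalPhysics.KineticTheory.HeatConduction.boxMarginal a n μT) ≤ C * (n + 1)) ∧ MeasureTheory.Integrable (fun σ => (Literature.MathematicalPhysics.KineticTheory.HeatConduction.pinnedChain ω₂ lam β γ).bondCurrentZ σ 0) ν ∧ ε ≤ |∫ σ, (Literature.MathematicalPhysics.KineticTheory.HeatConduction.pinnedChain ω₂ lam β γ).bondCurrentZ σ 0 ∂ν|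

-- `WindowLimit` holds: proved by `Summit.AtomisticToContinuum.FouriersLaw.Theorems.windowLimit_proof` @ 9f6e182e6f09 (its module imports this route file, so no `_holds` link can be stated here).

/-- item stmt-AtomisticToContinuum-9900 · support · rank 9 · closed · proved by Summit.AtomisticToContinuum.FouriersLaw.Theorems.pinnedSteadyStateExists_proof @ 192d41102e52 (prover) · by planner
sources: CuneoEckmannHairerReyBellet2018
[support] CLAUSE (i) EXISTENCE FOR THE CONJUNCT'S CHAIN (route-repair 2026-08-15, cone bookkeeping;
provable now; kind support, rank 9): for pinnedChain ω₂ lam β γ with ω₂, lam, β, γ > 0, every N and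
all T_L, T_R > 0 there is a weak (Fokker–Planck) steady state (OscillatorChain.IsSteadyState).
PROVED in tree:
Literature.MathematicalPhysics.KineticTheory.HeatConduction.pinnedChain_exists_isSteadyState
(LangevinChainNESSHolds.lean; the discharged fact CuneoEckmannHairerReyBellet2018_pinnedChain for N
≥ 1 + OscillatorChain.isSteadyState_zero for N = 0) — a Theorems file importing the route file +
LangevinChainNESSHolds closes it in one line (evidence file attached:
PinnedSteadyStateExistsProof.lean, rc 0, axioms propext/Classical.choice/Quot.sound). WHY AN ITEM:
it lets the deciding theorem 'closes' take clause (i) existence as a hypothesis, so that the Theses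
file can drop the import Literature.MathematicalPhysics.KineticTheory.LangevinChainNESSHolds
(≈55-module Langevin-SDE cone with the two undischarged Kolmogorov–Chentsov Hölder facts) — the
pending route-repair edit (imports := [InfiniteChainDynamics], closes re-proved, Assembly restated;
package attached as evidence to the route -/
@[route_item "route-AtomisticToContinuum-ParityLiouvilleSeed", crux]
def PinnedSteadyStateExists : Prop :=
  ∀ ω₂ lam β γ : ℝ, 0 < ω₂ → 0 < lam → 0 < β → 0 < γ → ∀ (N : ℕ) (T_L T_R : ℝ), 0 < T_L → 0 < T_R → ∃ μ : MeasureTheory.Measure (Literature.MathematicalPhysics.KineticTheory.HeatConduction.PhaseSpace N), (Literature.MathematicalPhysics.KineticTheory.HeatConduction.pinnedChain ω₂ lam β γ).IsSteadyState N T_L T_R μ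

/-- `PinnedSteadyStateExists` holds: proved by `Summit.AtomisticToContinuum.FouriersLaw.Theorems.pinnedSteadyStateExists_proof` @ 192d41102e52. -/
theorem PinnedSteadyStateExists_holds : PinnedSteadyStateExists := _root_.Summit.AtomisticToContinuum.FouriersLaw.Theorems.pinnedSteadyStateExists_proof

/-- item stmt-AtomisticToContinuum-13983 · assembly · rank 1 · closed · proved by Summit.AtomisticToContinuum.FouriersLaw.Theorems.parityLiouvilleSeed_assembly_proof (prover) · by planner
sources: BonettoLebowitzReyBellet2000, EyinkLebowitzSpohn1991, Hammersley1988
[assembly] NessUnique → PinnedSteadyStateExists → FiniteResponseOfUnique → PositiveConductance →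
ConductanceLowerBound → SuperadditiveResistance → SuperadditiveFekete → ZeroCurrentRigidity →
NessRegularity → NessTightness → WindowLimit → CesaroUpgrade → UniformLinearRegime → FouriersLaw
(the type of the proved `closes`). -/
@[route_item "route-AtomisticToContinuum-ParityLiouvilleSeed"]
def Assembly : Prop :=
  NessUnique → PinnedSteadyStateExists → FiniteResponseOfUnique → PositiveConductance → ConductanceLowerBound → SuperadditiveResistance → SuperadditiveFekete → ZeroCurrentRigidity → NessRegularity → NessTightness → WindowLimit → CesaroUpgrade → UniformLinearRegime → _root_.FouriersLaw

-- `Assembly` holds: proved by `Summit.AtomisticToContinuum.FouriersLaw.Theorems.parityLiouvilleSeed_assembly_proof` (its module imports this route file, so no `_holds` link can be stated here).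

/-! D-0027 §2.1 — DECIDING THEOREM (planner-authored via `route open/edit --closes-file`; by planner-rrepair-AtomisticToContinuum-ParityLio-f87fb797-0 2026-08-15T19:51:29Z):
its hypotheses are this route's items and its conclusion the sub-problem Statement (glue_lint), and it elaborates with this file. -/

@[closes "route-AtomisticToContinuum-ParityLiouvilleSeed"] theorem closes (hNU : NessUnique) (hE : PinnedSteadyStateExists) (hFR : FiniteResponseOfUnique)
    (hP : PositiveConductance) (hCL : ConductanceLowerBound) (hA : SuperadditiveResistance)
    (hF : SuperadditiveFekete) (hZ : ZeroCurrentRigidity) (hR : NessRegularity) (hT : NessTightness)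
    (hW : WindowLimit) (hCU : CesaroUpgrade) (hU : UniformLinearRegime) : _root_.FouriersLaw := by
  intro ω₂ lam β γ hω hl hβ hγ
  have huniq := hNU ω₂ lam β γ hω hl hβ hγ
  have hex := hE ω₂ lam β γ hω hl hβ hγ
  refine ⟨fun N T_L T_R hL' hR' => ?_, ?_⟩
  · obtain ⟨μ, hμ⟩ := hex N T_L T_R hL' hR'
    exact ⟨μ, hμ, fun ν hν => huniq N T_L T_R hL' hR' ν μ hν hμ⟩
  -- STEP A: the anti-ballistic rung at FIXED temperatures, for every steady family
  have hLiou : LiouvilleForHeat := hCU hZ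
  have antiB : ∀ T_L T_R : ℝ, 0 < T_L → 0 < T_R →
      ∀ ν : (N : ℕ) → MeasureTheory.Measure (Literature.MathematicalPhysics.KineticTheory.HeatConduction.PhaseSpace N),
        (∀ N, (Literature.MathematicalPhysics.KineticTheory.HeatConduction.pinnedChain ω₂ lam β γ).IsSteadyState N T_L T_R (ν N)) →
        Filter.Tendsto (fun N : ℕ =>
          (Literature.MathematicalPhysics.KineticTheory.HeatConduction.pinnedChain ω₂ lam β γ).totalCurrent (ν N) / ((N : ℝ) - 1))
          Filter.atTop (nhds 0) := by
    intro T_L T_R hL hRt ν hν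
    by_contra hnot
    rw [Metric.tendsto_nhds] at hnot
    push Not at hnot
    obtain ⟨ε, hε, hnev⟩ := hnot
    have hfreq : ∃ᶠ N in Filter.atTop,
        ε ≤ |(Literature.MathematicalPhysics.KineticTheory.HeatConduction.pinnedChain ω₂ lam β γ).totalCurrent (ν N) / ((N : ℝ) - 1)| := by
      refine hnev.mono fun N hN => ?_
      have hN' : ε ≤ dist ((Literature.MathematicalPhysics.KineticTheory.HeatConduction.pinnedChain ω₂ lam β γ).totalCurrent (ν N) /
          ((N : ℝ) - 1)) 0 := hN
      rwa [Real.dist_0_eq_abs] at hN'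
    -- moments and regularity of the family, from NessTightness / NessRegularity
    have hmom : ∀ m : ℕ, ∃ C : ℝ, ∀ (N : ℕ) (i : Fin N),
        MeasureTheory.Integrable (fun x => |x.1 i| ^ m + |x.2 i| ^ m) (ν N) ∧
          ∫ x, (|x.1 i| ^ m + |x.2 i| ^ m) ∂(ν N) ≤ C := by
      intro m
      obtain ⟨C, hC⟩ := hT ω₂ lam β γ hω hl hβ hγ T_L T_R hL hRt m
      exact ⟨C, fun N i => hC N (ν N) (hν N) i⟩
    obtain ⟨T', μT, hT', hG, hS, C, hCtop, hCreg⟩ := hR ω₂ lam β γ hω hl hβ hγ T_L T_R hL hRt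
    have hreg : ∃ (T : ℝ) (μT : MeasureTheory.Measure Literature.MathematicalPhysics.KineticTheory.HeatConduction.ChainConfig),
        0 < T ∧ (Literature.MathematicalPhysics.KineticTheory.HeatConduction.pinnedChain ω₂ lam β γ).IsChainGibbsMeasure T μT ∧
          Literature.MathematicalPhysics.KineticTheory.HeatConduction.IsShiftInvariant μT ∧ ∃ C : ENNReal, C ≠ ⊤ ∧
            ∀ (N : ℕ) (a n : ℕ) (h : a + (n + 1) ≤ N),
              InformationTheory.klDiv ((ν N).map (fun x => fun i : Fin (n + 1) =>
                (x.1 (Fin.castLE h (Fin.natAdd a i)), x.2 (Fin.castLE h (Fin.natAdd a i)))))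
                (Literature.MathematicalPhysics.KineticTheory.HeatConduction.boxMarginal (a : ℤ) n μT) ≤ C * (n + 1) :=
      ⟨T', μT, hT', hG, hS, C, hCtop, fun N a n h => hCreg N (ν N) (hν N) a n h⟩
    obtain ⟨νi, hprob, htime, hmomi, hregi, hint, hεle⟩ :=
      hW ω₂ lam β γ T_L T_R ν hν hmom hreg ε hε hfreq
    have hzero := hLiou ω₂ lam β γ hω hl hβ νi hprob htime hmomi hregi hint
    rw [hzero, abs_zero] at hεle
    exact absurd hεle (not_le.2 hε)
  -- STEP B: canonical family, and for each T > 0 the response limit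
  classical
  let μ₀ : (N : ℕ) → ℝ → ℝ →
      MeasureTheory.Measure (Literature.MathematicalPhysics.KineticTheory.HeatConduction.PhaseSpace N) :=
    fun N T_L T_R => if h : 0 < T_L ∧ 0 < T_R then Classical.choose (hex N T_L T_R h.1 h.2) else 0
  have hμ₀ : ∀ (N : ℕ) (T_L T_R : ℝ), 0 < T_L → 0 < T_R →
      (Literature.MathematicalPhysics.KineticTheory.HeatConduction.pinnedChain ω₂ lam β γ).IsSteadyState N T_L T_R (μ₀ N T_L T_R) := by
    intro N T_L T_R hL' hR'
    simp only [μ₀, dif_pos (And.intro hL' hR')]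
    exact Classical.choose_spec (hex N T_L T_R hL' hR')
  have key : ∀ T : ℝ, 0 < T → ∃ κT : ℝ, 0 < κT ∧ ∃ D : ℕ → ℝ,
      (∀ N : ℕ, Filter.Tendsto (fun δ : ℝ =>
        (Literature.MathematicalPhysics.KineticTheory.HeatConduction.pinnedChain ω₂ lam β γ).totalCurrent
          (μ₀ N (T + δ / 2) (T - δ / 2)) / δ) (nhdsWithin 0 {(0 : ℝ)}ᶜ) (nhds (D N))) ∧
      Filter.Tendsto D Filter.atTop (nhds κT) := by
    intro T hTpos
    have hDex := hFR ω₂ lam β γ hω hl hβ hγ huniq μ₀ hμ₀ T hTpos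
    choose D hD using hDex
    have hpos : ∀ N : ℕ, 2 ≤ N → 0 < D N := hP ω₂ lam β γ hω hl hβ hγ huniq μ₀ hμ₀ T hTpos D hD
    obtain ⟨c, hc, N₁, hN₁⟩ := hCL ω₂ lam β γ hω hl hβ hγ huniq μ₀ hμ₀ T hTpos D hD
    obtain ⟨C, hsuper⟩ := hA ω₂ lam β γ hω hl hβ hγ huniq μ₀ hμ₀ T hTpos D hD hpos
    -- NOT BALLISTIC at linear response, from the fixed-bias rung + the uniform linear regime
    have hNB : ∀ ε : ℝ, 0 < ε → ∀ N₀ : ℕ, ∃ N : ℕ, N₀ ≤ N ∧ D N ≤ ε * ((N : ℝ) - 1) := by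
      intro ε hε N₀
      obtain ⟨δ₀, hδ₀, hUδ⟩ := hU ω₂ lam β γ hω hl hβ hγ huniq μ₀ hμ₀ T hTpos D hD (ε / 4) (by positivity)
      set δ : ℝ := min (δ₀ / 2) T with hδdef
      have hδpos : 0 < δ := lt_min (by positivity) hTpos
      have hδlt : δ < δ₀ := lt_of_le_of_lt (min_le_left _ _) (by linarith)
      have hδT : δ ≤ T := min_le_right _ _
      have h1 : 0 < T + δ / 2 := by linarith
      have h2 : 0 < T - δ / 2 := by linarith
      have hfam : ∀ N, (Literature.MathematicalPhysics.KineticTheory.HeatConduction.pinnedChain ω₂ lam β γ).IsSteadyState N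
          (T + δ / 2) (T - δ / 2) (μ₀ N (T + δ / 2) (T - δ / 2)) := fun N => hμ₀ N _ _ h1 h2
      have hlim := antiB (T + δ / 2) (T - δ / 2) h1 h2 (fun N => μ₀ N (T + δ / 2) (T - δ / 2)) hfam
      have hev : ∀ᶠ N : ℕ in Filter.atTop, dist
          ((Literature.MathematicalPhysics.KineticTheory.HeatConduction.pinnedChain ω₂ lam β γ).totalCurrent
            (μ₀ N (T + δ / 2) (T - δ / 2)) / ((N : ℝ) - 1)) 0 < ε / 4 * δ :=
        Metric.tendsto_nhds.1 hlim _ (by positivity)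
      have hUev : ∀ᶠ N : ℕ in Filter.atTop,
          |(Literature.MathematicalPhysics.KineticTheory.HeatConduction.pinnedChain ω₂ lam β γ).totalCurrent
              (μ₀ N (T + δ / 2) (T - δ / 2)) / δ - D N| ≤ ε / 4 * (N : ℝ) := hUδ δ hδpos hδlt
      obtain ⟨N, hNge, hNd, hUN⟩ := ((Filter.eventually_ge_atTop (max N₀ 2)).and (hev.and hUev)).exists
      have hN₀ : N₀ ≤ N := le_trans (le_max_left _ _) hNge
      have hN2 : 2 ≤ N := le_trans (le_max_right _ _) hNge
      have hN2r : (2 : ℝ) ≤ (N : ℝ) := by exact_mod_cast hN2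
      refine ⟨N, hN₀, ?_⟩
      set t : ℝ := (Literature.MathematicalPhysics.KineticTheory.HeatConduction.pinnedChain ω₂ lam β γ).totalCurrent
          (μ₀ N (T + δ / 2) (T - δ / 2)) with htdef
      rw [Real.dist_0_eq_abs] at hNd
      have hNm1 : 0 < (N : ℝ) - 1 := by linarith
      have ht : |t| < ε / 4 * δ * ((N : ℝ) - 1) := by
        rw [abs_div, abs_of_pos hNm1, div_lt_iff₀ hNm1] at hNd
        exact hNd
      have htδ : |t / δ| < ε / 4 * ((N : ℝ) - 1) := by
        rw [abs_div, abs_of_pos hδpos, div_lt_iff₀ hδpos]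
        calc |t| < ε / 4 * δ * ((N : ℝ) - 1) := ht
          _ = ε / 4 * ((N : ℝ) - 1) * δ := by ring
      have hDle : D N ≤ |t / δ - D N| + |t / δ| := by
        have := abs_sub_abs_le_abs_sub (D N) (t / δ)
        have h' : D N ≤ |D N| := le_abs_self _
        rw [abs_sub_comm] at this
        linarith
      have hNle : (N : ℝ) ≤ 2 * ((N : ℝ) - 1) := by linarith
      calc D N ≤ |t / δ - D N| + |t / δ| := hDle
        _ ≤ ε / 4 * (N : ℝ) + ε / 4 * ((N : ℝ) - 1) := by linarith [hUN, htδ.le]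
        _ ≤ ε / 4 * (2 * ((N : ℝ) - 1)) + ε / 4 * ((N : ℝ) - 1) := by gcongr
        _ ≤ ε * ((N : ℝ) - 1) := by nlinarith [hNm1, hε]
    obtain ⟨κT, hκpos, hκ⟩ := hF D C c hc hpos ⟨N₁, hN₁⟩ hsuper hNB
    exact ⟨κT, hκpos, D, hD, hκ⟩
  -- STEP C: the conductivity function and the transfer to every steady-state family
  choose κf hκpos Df hDf hDlim using key
  refine ⟨fun T => if hT : 0 < T then κf T hT else 1, fun T hT => ?_, ?_⟩
  · simp only [dif_pos hT]; exact hκpos T hT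
  intro μ hμ T hT
  refine ⟨Df T hT, fun N => ?_, ?_⟩
  · refine (hDf T hT N).congr' ?_
    have h2 : ∀ᶠ δ in nhds (0 : ℝ), δ < 2 * T := eventually_lt_nhds (by linarith)
    have h2' : ∀ᶠ δ in nhds (0 : ℝ), -(2 * T) < δ := eventually_gt_nhds (by linarith)
    filter_upwards [mem_nhdsWithin_of_mem_nhds h2, mem_nhdsWithin_of_mem_nhds h2'] with δ hlt hgt
    have ha : 0 < T + δ / 2 := by linarith
    have hb : 0 < T - δ / 2 := by linarith
    rw [huniq N _ _ ha hb (μ₀ N _ _) (μ N _ _) (hμ₀ N _ _ ha hb) (hμ N _ _ ha hb)]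
  · simp only [dif_pos hT]; exact hDlim T hT

end Summit.AtomisticToContinuum.FouriersLaw.Theses.ParityLiouvilleSeed
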